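import Mathlib.Analysis.SpecialFunctions.Integrals.Basic
import Summits.NavierStokesRegularity.NavierStokesRegularity.Theorems.PerpetualPumpAveragedTypeIBlowupPreviousPairTools

/-!
# Crux `PerpetualPump.AveragedTypeIBlowup` (stmt-NavierStokesRegularity-1835), line `Sketch`:
# stub `previousPair` — a priori estimates inside the bootstrap tube, I (rates, forcing, majorant)

Estimates for the pair `(bp, wp)` behind the front after a hand-off (carrier and spent bond one
scale below the new front `b ≈ B e^{-σ}`), in slow time `σ ∈ [0, T]` of the new front:
`bp' = κ(-bp - wp² + wl² - εb bp wp) + e0`, `wp' = κ(wp (bp - b/q - 1) + εb bp²) + e1`,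
i.e. `wp' = -κ R wp + F` with the rate `R = b/q + 1 - bp` and the forcing `F = κ εb bp² + e1`.

All statements are conditional on the BOOTSTRAP TUBE on `[0, s] ⊆ [0, T]`
(`-1/2 ≤ bp ≤ 9/10`, `bp ≤ 2/5` after `σI`, `m1 ≤ μ + 3√B`, `κ ∫₀^σ wp² ≤ 1`), bundled with
the standing hypotheses of the stub as section variables. This file: the rate bounds
(`R ≥ 1/10` always, `R ≥ B/25` before `σI`, `R ≥ (B-33)/q` during the dump `σ ≤ 30/B`,
`R ≤ B + 9/2`), the forcing bound `|F| ≤ κ ω / 4`, the `L¹` transfer bound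
`κ ∫₀^σ R |wp| ≤ wp(0) + κωσ/4` (from `previousPair_l1_le`), and the SHARP bond-majorant bound
`m1 ≤ μ + 2√B` (registered sub-goal `stub_prevPairRates`), which closes the tube
condition `m1 ≤ μ + 3√B` with room. Continued in `…PreviousPairDecay` (decay of `wp`),
`…PreviousPairDump` (energy bounds), `…PreviousPairCarrier` (the carrier `bp`) and closed in
`…PreviousPair`.

## References

T. Tao, *Finite time blowup for an averaged three-dimensional Navier–Stokes equation*, J. Amer.
Math. Soc. 29 (2016), §5–6 (the circuit); the estimates themselves are folklore ODE calculus.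
-/

noncomputable section

-- the summit namespace `…NavierStokesRegularity.NavierStokesRegularity…` is the tree convention
set_option linter.dupNamespace false
-- every lemma of this file lives inside one `variable … include` context (the bootstrap tube);
-- not every lemma uses every bundled hypothesis
set_option linter.unusedSectionVars false

open MeasureTheory Set Filter Topology

namespace Summit.NavierStokesRegularity.NavierStokesRegularity.Theorems.PerpetualPumpAveragedTypeIBlowup

section Tube

variable {bp wp b m0 m1 wl e0 e1 : ℝ → ℝ} {B Λ κ q θ η εb ω μ σI T s : ℝ}

variable (hκq : 4 / 5 ≤ κ ∧ κ ≤ 1 ∧ 1 ≤ q ∧ q ≤ 21 / 20)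
  (hsm : 0 ≤ η ∧ 0 < εb ∧ 10 * εb ≤ ω ∧ ω ≤ 1 / 100 ∧ 0 ≤ μ ∧
    η * (μ + 2 * Real.sqrt B) ≤ ω / 10 ∧ η * μ ≤ 1 / 20 ∧ 1 / 2 ≤ θ ∧ θ ≤ 1)
  (hBT : 1000 ≤ B ∧ 0 < σI ∧ σI ≤ 3 ∧ 0 < T ∧ T ≤ 10)
  (hΛ : 100 ≤ Λ ∧ Λ ≤ B * (1 - Real.exp (-σI)) ∧
    11 * Real.sqrt B * Real.exp (-(κ * Λ / 3)) ≤ ω)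
  (hcont : ContinuousOn bp (Icc 0 T) ∧ ContinuousOn wp (Icc 0 T) ∧ ContinuousOn b (Icc 0 T) ∧
    ContinuousOn m0 (Icc 0 T) ∧ ContinuousOn m1 (Icc 0 T) ∧ ContinuousOn wl (Icc 0 T) ∧
    ContinuousOn e0 (Icc 0 T) ∧ ContinuousOn e1 (Icc 0 T))
  (hode : (∀ σ ∈ Ioo 0 T, HasDerivAt bp
      (κ * (-(bp σ) - (wp σ) ^ 2 + (wl σ) ^ 2 - εb * bp σ * wp σ) + e0 σ) σ) ∧
    (∀ σ ∈ Ioo 0 T, HasDerivAt wp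
      (κ * (wp σ * (bp σ - b σ / q - 1) + εb * (bp σ) ^ 2) + e1 σ) σ))
  (herr : (∀ σ ∈ Icc 0 T, |e0 σ| ≤ η * κ * m0 σ) ∧ (∀ σ ∈ Icc 0 T, |e1 σ| ≤ η * κ * m1 σ) ∧
    (∀ σ ∈ Icc 0 T, 0 ≤ m0 σ ∧ m0 σ ≤ m0 0 * Real.exp (-(θ * κ * σ)) +
      κ * ∫ u in (0 : ℝ)..σ, Real.exp (-(θ * κ * (σ - u))) *
        |-(wp u) ^ 2 + (wl u) ^ 2 - εb * bp u * wp u|) ∧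
    (∀ σ ∈ Icc 0 T, 0 ≤ m1 σ ∧ m1 σ ≤ m1 0 * Real.exp (-(θ * κ * σ)) +
      κ * ∫ u in (0 : ℝ)..σ, Real.exp (-(θ * κ * (σ - u))) *
        |wp u * (bp u - b u / q) + εb * (bp u) ^ 2|))
  (henv : (∀ σ ∈ Icc 0 T, |wl σ| ≤ ω) ∧
    (∀ σ ∈ Icc 0 (min T σI), B * Real.exp (-σ) - 3 ≤ b σ) ∧
    (∀ σ ∈ Icc 0 T, -(1 / 2) ≤ b σ ∧ b σ ≤ B + 3))
  (hini : q ^ 4 / 2 - 3 / 20 ≤ bp 0 ∧ bp 0 ≤ q ^ 4 / 2 + 1 / 10 ∧ 0 ≤ wp 0 ∧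
    q ^ 3 * B - 1 ≤ (wp 0) ^ 2 ∧ (wp 0) ^ 2 ≤ q ^ 3 * B + 1 ∧ m0 0 ≤ μ ∧ m1 0 ≤ μ)
  (hs : s ∈ Icc 0 T)
  (hT : ∀ σ ∈ Icc 0 s, -(1 / 2) ≤ bp σ ∧ bp σ ≤ 9 / 10 ∧ (σ ≤ σI ∨ bp σ ≤ 2 / 5) ∧
    m1 σ ≤ μ + 3 * Real.sqrt B ∧ κ * ∫ u in (0 : ℝ)..σ, (wp u) ^ 2 ≤ 1)

include hκq hsm hBT hΛ hcont hode herr henv hini hs hT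

/-- `σI ≥ 30/B` (from `100 ≤ Λ ≤ B(1 - e^{-σI}) ≤ B σI`) and `√B ≥ 31`. [folklore] -/
theorem prevPair_consts : 30 / B ≤ σI ∧ 31 ≤ Real.sqrt B ∧ η ≤ ω / 620 := by
  obtain ⟨hB, hσI0, -, -, -⟩ := hBT
  obtain ⟨hΛ1, hΛ2, -⟩ := hΛ
  obtain ⟨hη, -, -, -, hμ, hημB, -, -, -⟩ := hsm
  have hB0 : 0 < B := by linarith
  have hsq : 31 ≤ Real.sqrt B := (Real.le_sqrt' (by norm_num)).2 (by linarith)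
  refine ⟨?_, hsq, ?_⟩
  · have h1 : 1 - Real.exp (-σI) ≤ σI := by linarith [Real.one_sub_le_exp_neg σI]
    have h2 : Λ ≤ B * σI := hΛ2.trans (mul_le_mul_of_nonneg_left h1 hB0.le)
    rw [div_le_iff₀ hB0]
    nlinarith
  · have h1 : η * (2 * Real.sqrt B) ≤ ω / 10 := by nlinarith [mul_nonneg hη hμ]
    have h2 : η * 62 ≤ η * (2 * Real.sqrt B) := by nlinarith
    linarith

/-- **Rate bounds inside the tube.** On `[0, s]`: `R = b/q + 1 - bp ≥ 1/10`, `R ≤ B + 9/2`;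
before `σI`, `R ≥ B/25 + 1/10`; during the dump `σ ≤ 30/B`, `R ≥ (B - 33)/q + 1/10`. [folklore] -/
theorem prevPair_rate {σ : ℝ} (hσ : σ ∈ Icc 0 s) :
    1 / 10 ≤ b σ / q + 1 - bp σ ∧ b σ / q + 1 - bp σ ≤ B + 9 / 2 ∧
      (σ ≤ σI → B / 25 + 1 / 10 ≤ b σ / q + 1 - bp σ) ∧
      (σ ≤ 30 / B → (B - 33) / q + 1 / 10 ≤ b σ / q + 1 - bp σ) := by
  obtain ⟨hσB, -, -⟩ := prevPair_consts hκq hsm hBT hΛ hcont hode herr henv hini hs hT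
  obtain ⟨-, -, hq1, hq2⟩ := hκq
  obtain ⟨hB, -, hσI3, -, -⟩ := hBT
  obtain ⟨-, hfront, hb⟩ := henv
  have hq0 : 0 < q := by linarith
  have hB0 : 0 < B := by linarith
  have hσT : σ ∈ Icc 0 T := ⟨hσ.1, hσ.2.trans hs.2⟩
  obtain ⟨hbp1, hbp2, hbp3, -, -⟩ := hT σ hσ
  obtain ⟨hb1, hb2⟩ := hb σ hσT
  -- before `σI`
  have hfr : σ ≤ σI → B / 25 + 1 / 10 ≤ b σ / q + 1 - bp σ := by
    intro hσI
    have hbσ := hfront σ ⟨hσ.1, le_min hσT.2 hσI⟩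
    have h20 := previousPair_exp_neg_three_ge (hσI.trans hσI3)
    have h1 : B ≤ 201 / 10 * Real.exp (-σ) * B := by nlinarith
    have key : q * (B / 25) ≤ b σ := by nlinarith
    have : B / 25 ≤ b σ / q := (le_div_iff₀ hq0).2 (by linarith)
    linarith
  refine ⟨?_, ?_, hfr, ?_⟩
  · rcases hbp3 with h | h
    · linarith [hfr h, div_nonneg hB0.le (by norm_num : (0 : ℝ) ≤ 25)]
    · have : -(1 / 2) ≤ b σ / q := by
        rw [le_div_iff₀ hq0]; nlinarith
      linarith
  · have : b σ / q ≤ B + 3 := (div_le_iff₀ hq0).2 (by nlinarith)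
    linarith
  · intro hσd
    have hσI : σ ≤ σI := hσd.trans hσB
    have hbσ := hfront σ ⟨hσ.1, le_min hσT.2 hσI⟩
    have h1 : 1 - σ ≤ Real.exp (-σ) := Real.one_sub_le_exp_neg σ
    have h2 : B * σ ≤ 30 := by rwa [le_div_iff₀ hB0, mul_comm] at hσd
    have h3 : B - 33 ≤ b σ := by nlinarith
    have : (B - 33) / q ≤ b σ / q := div_le_div_of_nonneg_right h3 hq0.le
    linarith

/-- **Forcing bound inside the tube.** `|F| = |κ εb bp² + e1| ≤ κ ω / 4` on `[0, s]`
(`εb ≤ ω/10`, `bp² ≤ 81/100`, `|e1| ≤ η κ m1 ≤ η κ (μ + 3√B) ≤ 3κω/20`). [folklore] -/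
theorem prevPair_F_le {σ : ℝ} (hσ : σ ∈ Icc 0 s) :
    |κ * εb * bp σ ^ 2 + e1 σ| ≤ κ * ω / 4 := by
  obtain ⟨hκ0, -, -, -⟩ := hκq
  obtain ⟨hη, hεb, hεω, -, hμ, hημB, -, -, -⟩ := hsm
  obtain ⟨-, he1, -, -⟩ := herr
  have hσT : σ ∈ Icc 0 T := ⟨hσ.1, hσ.2.trans hs.2⟩
  obtain ⟨hbp1, hbp2, -, hm1, -⟩ := hT σ hσ
  have hκ : 0 < κ := by linarith
  have h1 : |κ * εb * bp σ ^ 2| ≤ κ * (ω / 10) * (81 / 100) := by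
    rw [abs_of_nonneg (by positivity)]
    have : bp σ ^ 2 ≤ 81 / 100 := by nlinarith
    have : εb * bp σ ^ 2 ≤ ω / 10 * (81 / 100) :=
      mul_le_mul (by linarith) this (sq_nonneg _) (by linarith)
    nlinarith
  have h2 : |e1 σ| ≤ κ * (3 / 20 * ω) := by
    refine (he1 σ hσT).trans ?_
    have h3 : η * m1 σ ≤ η * (μ + 3 * Real.sqrt B) := mul_le_mul_of_nonneg_left hm1 hη
    have h4 : η * (μ + 3 * Real.sqrt B) ≤ 3 / 2 * (η * (μ + 2 * Real.sqrt B)) := by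
      nlinarith [mul_nonneg hη hμ]
    have h5 : η * κ * m1 σ = κ * (η * m1 σ) := by ring
    rw [h5]
    exact mul_le_mul_of_nonneg_left (by linarith) hκ.le
  calc |κ * εb * bp σ ^ 2 + e1 σ| ≤ |κ * εb * bp σ ^ 2| + |e1 σ| := abs_add_le _ _
    _ ≤ κ * (ω / 10) * (81 / 100) + κ * (3 / 20 * ω) := add_le_add h1 h2
    _ ≤ κ * ω / 4 := by nlinarith

/-- The bond equation in damped form: `wp' = -κ R wp + F` on `(0, s)`. [folklore] -/
theorem prevPair_wp_ode {σ : ℝ} (hσ : σ ∈ Ioo 0 s) :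
    HasDerivAt wp (-(κ * (b σ / q + 1 - bp σ) * wp σ) + (κ * εb * bp σ ^ 2 + e1 σ)) σ :=
  (hode.2 σ ⟨hσ.1, hσ.2.trans_le hs.2⟩).congr_deriv (by ring)

/-- Continuity of the rate, the forcing and the bond on `[0, s]`. [folklore] -/
theorem prevPair_cont :
    ContinuousOn (fun σ => b σ / q + 1 - bp σ) (Icc 0 s) ∧
      ContinuousOn (fun σ => κ * εb * bp σ ^ 2 + e1 σ) (Icc 0 s) ∧
      ContinuousOn wp (Icc 0 s) ∧ ContinuousOn bp (Icc 0 s) := by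
  obtain ⟨hbp, hwp, hb, -, -, -, -, he1⟩ := hcont
  have hsub : Icc 0 s ⊆ Icc 0 T := Icc_subset_Icc_right hs.2
  refine ⟨((hb.mono hsub).div_const q |>.add continuousOn_const).sub (hbp.mono hsub), ?_,
    hwp.mono hsub, hbp.mono hsub⟩
  exact (continuousOn_const.mul ((hbp.mono hsub).pow 2)).add (he1.mono hsub)

/-- **`L¹` bound on the transfer.** `κ ∫₀^σ R |wp| ≤ wp(0) + κ ω σ / 4` on `[0, s]`. [folklore] -/
theorem prevPair_l1 {σ : ℝ} (hσ : σ ∈ Icc 0 s) :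
    κ * ∫ u in (0 : ℝ)..σ, (b u / q + 1 - bp u) * |wp u| ≤ wp 0 + κ * ω / 4 * σ := by
  obtain ⟨hRc, hFc, hwpc, -⟩ := prevPair_cont hκq hsm hBT hΛ hcont hode herr henv hini hs hT
  have hoder := fun (t : ℝ) (ht : t ∈ Ioo 0 s) =>
    prevPair_wp_ode hκq hsm hBT hΛ hcont hode herr henv hini hs hT ht
  have hrate := fun (t : ℝ) (ht : t ∈ Icc 0 s) =>
    prevPair_rate hκq hsm hBT hΛ hcont hode herr henv hini hs hT ht
  have hFle := fun (t : ℝ) (ht : t ∈ Icc 0 s) =>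
    prevPair_F_le hκq hsm hBT hΛ hcont hode herr henv hini hs hT ht
  obtain ⟨hκ0, -, -, -⟩ := hκq
  have hwp0 : 0 ≤ wp 0 := hini.2.2.1
  have h := previousPair_l1_le (x := wp) (R := fun u => b u / q + 1 - bp u)
    (F := fun u => κ * εb * bp u ^ 2 + e1 u) (t₀ := 0) (t₁ := s) (κ := κ) (by linarith)
    hwpc hRc hFc hoder (fun t ht => by linarith [(hrate t ht).1]) hσ
  have hF : ∫ u in (0 : ℝ)..σ, |κ * εb * bp u ^ 2 + e1 u| ≤ ∫ _ in (0 : ℝ)..σ, κ * ω / 4 := by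
    refine intervalIntegral.integral_mono_on hσ.1
      ((hFc.abs.mono (Icc_subset_Icc_right hσ.2)).intervalIntegrable_of_Icc hσ.1)
      intervalIntegrable_const fun u hu => ?_
    exact hFle u ⟨hu.1, hu.2.trans hσ.2⟩
  rw [intervalIntegral.integral_const, smul_eq_mul, sub_zero, abs_of_nonneg hwp0] at *
  linarith

/-- **Sharp bond-majorant bound.** `m1 ≤ μ + 2√B` on `[0, s]`: the Volterra majorant is at most
`μ + κ ∫ (R |wp| + |wp| + εb bp²) ≤ μ + wp(0) + 6 ≤ μ + 1.1 √B + 6`. [folklore] -/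
theorem prevPair_m1 {σ : ℝ} (hσ : σ ∈ Icc 0 s) : m1 σ ≤ μ + 2 * Real.sqrt B := by
  have hl1 := prevPair_l1 hκq hsm hBT hΛ hcont hode herr henv hini hs hT hσ
  have hrate := fun (t : ℝ) (ht : t ∈ Icc 0 s) =>
    prevPair_rate hκq hsm hBT hΛ hcont hode herr henv hini hs hT ht
  obtain ⟨hRc, -, hwpc, hbpc⟩ := prevPair_cont hκq hsm hBT hΛ hcont hode herr henv hini hs hT
  obtain ⟨-, hsq, -⟩ := prevPair_consts hκq hsm hBT hΛ hcont hode herr henv hini hs hT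
  obtain ⟨hκ0, hκ1, hq1, hq2⟩ := hκq
  obtain ⟨-, hεb, hεω, hω, hμ, -, -, hθ1, -⟩ := hsm
  obtain ⟨hB, -, -, -, hT10⟩ := hBT
  obtain ⟨-, -, -, hm1⟩ := herr
  obtain ⟨-, -, hwp0, -, hwp0sq, -, hm10μ⟩ := hini
  have hbc : ContinuousOn b (Icc 0 s) := hcont.2.2.1.mono (Icc_subset_Icc_right hs.2)
  have hσT : σ ∈ Icc 0 T := ⟨hσ.1, hσ.2.trans hs.2⟩
  have hκ : 0 < κ := by linarith
  -- the initial term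
  have hm10 : 0 ≤ m1 0 := (hm1 0 ⟨le_rfl, hs.1.trans hs.2⟩).1
  have hexp : Real.exp (-(θ * κ * σ)) ≤ 1 :=
    Real.exp_le_one_iff.2 (by nlinarith [mul_nonneg (mul_nonneg (by linarith : (0:ℝ) ≤ θ) hκ.le) hσ.1])
  have hA : m1 0 * Real.exp (-(θ * κ * σ)) ≤ μ := (mul_le_of_le_one_right hm10 hexp).trans hm10μ
  -- the integrand
  have hpt : ∀ u ∈ Icc 0 σ, Real.exp (-(θ * κ * (σ - u))) *
      |wp u * (bp u - b u / q) + εb * bp u ^ 2| ≤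
      (b u / q + 1 - bp u) * |wp u| + 1 / 2 * wp u ^ 2 + (1 / 2 + εb) := by
    intro u hu
    have huS : u ∈ Icc 0 s := ⟨hu.1, hu.2.trans hσ.2⟩
    have hR := (hrate u huS).1
    obtain ⟨hbp1, hbp2, -, -, -⟩ := hT u huS
    have he : Real.exp (-(θ * κ * (σ - u))) ≤ 1 :=
      Real.exp_le_one_iff.2 (by
        nlinarith [mul_nonneg (mul_nonneg (by linarith : (0:ℝ) ≤ θ) hκ.le)
          (by linarith [hu.2] : (0:ℝ) ≤ σ - u)])
    have habs : |wp u * (bp u - b u / q) + εb * bp u ^ 2| ≤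
        |wp u| * |bp u - b u / q| + εb * bp u ^ 2 := by
      calc _ ≤ |wp u * (bp u - b u / q)| + |εb * bp u ^ 2| := abs_add_le _ _
        _ = _ := by rw [abs_mul, abs_of_nonneg (by positivity : (0:ℝ) ≤ εb * bp u ^ 2)]
    have h1 : |bp u - b u / q| ≤ (b u / q + 1 - bp u) + 1 := by
      rw [abs_le]; constructor <;> linarith
    have h2 : εb * bp u ^ 2 ≤ εb := by
      have : bp u ^ 2 ≤ 1 := by nlinarith
      nlinarith
    have h3 : |wp u| ≤ (1 + wp u ^ 2) / 2 := by nlinarith [sq_nonneg (|wp u| - 1), sq_abs (wp u)]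
    calc _ ≤ |wp u * (bp u - b u / q) + εb * bp u ^ 2| := mul_le_of_le_one_left (abs_nonneg _) he
      _ ≤ |wp u| * |bp u - b u / q| + εb * bp u ^ 2 := habs
      _ ≤ |wp u| * ((b u / q + 1 - bp u) + 1) + εb :=
          add_le_add (mul_le_mul_of_nonneg_left h1 (abs_nonneg _)) h2
      _ ≤ _ := by nlinarith [h3, abs_nonneg (wp u)]
  -- integrate
  have hσ0 := hσ.1
  have hIc : ContinuousOn (fun u => Real.exp (-(θ * κ * (σ - u))) *
      |wp u * (bp u - b u / q) + εb * bp u ^ 2|) (Icc 0 σ) := by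
    refine (Continuous.continuousOn (by fun_prop)).mul ?_
    have hsub : Icc 0 σ ⊆ Icc 0 s := Icc_subset_Icc_right hσ.2
    exact (((hwpc.mono hsub).mul ((hbpc.mono hsub).sub ((hbc.mono hsub).div_const q))).add
      (continuousOn_const.mul ((hbpc.mono hsub).pow 2))).abs
  have hJc : ContinuousOn (fun u => (b u / q + 1 - bp u) * |wp u| + 1 / 2 * wp u ^ 2 +
      (1 / 2 + εb)) (Icc 0 σ) := by
    have hsub : Icc 0 σ ⊆ Icc 0 s := Icc_subset_Icc_right hσ.2
    exact (((hRc.mono hsub).mul (hwpc.mono hsub).abs).add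
      (continuousOn_const.mul ((hwpc.mono hsub).pow 2))).add continuousOn_const
  have hint := intervalIntegral.integral_mono_on hσ0
    (hIc.intervalIntegrable_of_Icc (μ := volume) hσ0)
    (hJc.intervalIntegrable_of_Icc (μ := volume) hσ0) hpt
  have hsub : Icc 0 σ ⊆ Icc 0 s := Icc_subset_Icc_right hσ.2
  have hI1 : IntervalIntegrable (fun u => (b u / q + 1 - bp u) * |wp u|) volume 0 σ :=
    ((hRc.mono hsub).mul (hwpc.mono hsub).abs).intervalIntegrable_of_Icc hσ0
  have hI2 : IntervalIntegrable (fun u => 1 / 2 * wp u ^ 2) volume 0 σ :=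
    (continuousOn_const.mul ((hwpc.mono hsub).pow 2)).intervalIntegrable_of_Icc hσ0
  rw [intervalIntegral.integral_add (hI1.add hI2) intervalIntegrable_const,
    intervalIntegral.integral_add hI1 hI2, intervalIntegral.integral_const_mul,
    intervalIntegral.integral_const, smul_eq_mul, sub_zero] at hint
  obtain ⟨-, -, -, -, hQ⟩ := hT σ hσ
  have hwp0' : wp 0 ≤ 11 / 10 * Real.sqrt B := by
    have hB0 : (0:ℝ) ≤ B := by linarith
    have hq3 : q ^ 3 ≤ 1158 / 1000 := by nlinarith [pow_le_pow_left₀ (by linarith) hq2 3]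
    have h1 : wp 0 ^ 2 ≤ (11 / 10 * Real.sqrt B) ^ 2 := by
      rw [mul_pow, Real.sq_sqrt hB0]; nlinarith
    exact (pow_le_pow_iff_left₀ hwp0 (by positivity) two_ne_zero).1 h1
  have hm1le := (hm1 σ hσT).2
  -- name the integrals and finish with linear arithmetic
  generalize (∫ u in (0:ℝ)..σ, Real.exp (-(θ * κ * (σ - u))) *
      |wp u * (bp u - b u / q) + εb * bp u ^ 2|) = Ia at hm1le hint
  generalize (∫ u in (0:ℝ)..σ, (b u / q + 1 - bp u) * |wp u|) = Ib at hl1 hint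
  generalize (∫ u in (0:ℝ)..σ, wp u ^ 2) = Iq at hQ hint
  have hσ10 : σ ≤ 10 := hσ.2.trans (hs.2.trans hT10)
  have hε : εb ≤ 1 / 1000 := by linarith only [hεω, hω]
  have hω0 : 0 ≤ ω := by linarith only [hεb, hεω]
  have hκσ : κ * σ ≤ 10 := by nlinarith only [hκ1, hσ10, hκ.le, hσ0]
  have h1 : κ * Ia ≤ κ * (Ib + 1 / 2 * Iq + σ * (1 / 2 + εb)) := mul_le_mul_of_nonneg_left hint hκ.le
  have h2 : κ * (Ib + 1 / 2 * Iq + σ * (1 / 2 + εb)) =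
      κ * Ib + 1 / 2 * (κ * Iq) + (κ * σ) * (1 / 2 + εb) := by ring
  have h3 : (κ * σ) * (1 / 2 + εb) ≤ 10 * (1 / 2 + 1 / 1000) :=
    mul_le_mul hκσ (by linarith only [hε]) (by linarith only [hεb]) (by norm_num)
  have h4 : κ * ω / 4 * σ ≤ 10 * (1 / 100) / 4 := by
    have : κ * ω / 4 * σ = (κ * σ) * ω / 4 := by ring
    rw [this]
    nlinarith only [mul_le_mul_of_nonneg_right hκσ hω0, hω]
  linarith only [hsq, h1, h2, h3, h4, hl1, hQ, hA, hm1le, hwp0']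

end Tube

/-- **Registered sub-goal `stub_prevPairRates`** (stub `previousPair`, line `Sketch`):
inside the bootstrap tube on `[0, s]`, the bond majorant obeys the SHARP bound `m1 ≤ μ + 2√B`
(so the tube condition `m1 ≤ μ + 3√B` is never saturated). [folklore] -/
theorem stub_prevPairRates :
    ∀ (bp wp b m0 m1 wl e0 e1 : ℝ → ℝ) (B Λ κ q θ η εb ω μ σI T s : ℝ),
      (4 / 5 ≤ κ ∧ κ ≤ 1 ∧ 1 ≤ q ∧ q ≤ 21 / 20) →
      (0 ≤ η ∧ 0 < εb ∧ 10 * εb ≤ ω ∧ ω ≤ 1 / 100 ∧ 0 ≤ μ ∧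
        η * (μ + 2 * Real.sqrt B) ≤ ω / 10 ∧ η * μ ≤ 1 / 20 ∧ 1 / 2 ≤ θ ∧ θ ≤ 1) →
      (1000 ≤ B ∧ 0 < σI ∧ σI ≤ 3 ∧ 0 < T ∧ T ≤ 10) →
      (100 ≤ Λ ∧ Λ ≤ B * (1 - Real.exp (-σI)) ∧
        11 * Real.sqrt B * Real.exp (-(κ * Λ / 3)) ≤ ω) →
      (ContinuousOn bp (Icc 0 T) ∧ ContinuousOn wp (Icc 0 T) ∧ ContinuousOn b (Icc 0 T) ∧
        ContinuousOn m0 (Icc 0 T) ∧ ContinuousOn m1 (Icc 0 T) ∧ ContinuousOn wl (Icc 0 T) ∧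
        ContinuousOn e0 (Icc 0 T) ∧ ContinuousOn e1 (Icc 0 T)) →
      ((∀ σ ∈ Ioo 0 T, HasDerivAt bp
          (κ * (-(bp σ) - (wp σ) ^ 2 + (wl σ) ^ 2 - εb * bp σ * wp σ) + e0 σ) σ) ∧
        (∀ σ ∈ Ioo 0 T, HasDerivAt wp
          (κ * (wp σ * (bp σ - b σ / q - 1) + εb * (bp σ) ^ 2) + e1 σ) σ)) →
      ((∀ σ ∈ Icc 0 T, |e0 σ| ≤ η * κ * m0 σ) ∧ (∀ σ ∈ Icc 0 T, |e1 σ| ≤ η * κ * m1 σ) ∧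
        (∀ σ ∈ Icc 0 T, 0 ≤ m0 σ ∧ m0 σ ≤ m0 0 * Real.exp (-(θ * κ * σ)) +
          κ * ∫ u in (0 : ℝ)..σ, Real.exp (-(θ * κ * (σ - u))) *
            |-(wp u) ^ 2 + (wl u) ^ 2 - εb * bp u * wp u|) ∧
        (∀ σ ∈ Icc 0 T, 0 ≤ m1 σ ∧ m1 σ ≤ m1 0 * Real.exp (-(θ * κ * σ)) +
          κ * ∫ u in (0 : ℝ)..σ, Real.exp (-(θ * κ * (σ - u))) *
            |wp u * (bp u - b u / q) + εb * (bp u) ^ 2|)) →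
      ((∀ σ ∈ Icc 0 T, |wl σ| ≤ ω) ∧
        (∀ σ ∈ Icc 0 (min T σI), B * Real.exp (-σ) - 3 ≤ b σ) ∧
        (∀ σ ∈ Icc 0 T, -(1 / 2) ≤ b σ ∧ b σ ≤ B + 3)) →
      (q ^ 4 / 2 - 3 / 20 ≤ bp 0 ∧ bp 0 ≤ q ^ 4 / 2 + 1 / 10 ∧ 0 ≤ wp 0 ∧
        q ^ 3 * B - 1 ≤ (wp 0) ^ 2 ∧ (wp 0) ^ 2 ≤ q ^ 3 * B + 1 ∧ m0 0 ≤ μ ∧ m1 0 ≤ μ) →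
      (s ∈ Icc 0 T) →
      (∀ σ ∈ Icc 0 s, -(1 / 2) ≤ bp σ ∧ bp σ ≤ 9 / 10 ∧ (σ ≤ σI ∨ bp σ ≤ 2 / 5) ∧
        m1 σ ≤ μ + 3 * Real.sqrt B ∧ κ * ∫ u in (0 : ℝ)..σ, (wp u) ^ 2 ≤ 1) →
      ∀ σ ∈ Icc 0 s, m1 σ ≤ μ + 2 * Real.sqrt B :=
  fun _ _ _ _ _ _ _ _ _ _ _ _ _ _ _ _ _ _ _ _ hκq hsm hBT hΛ hcont hode herr henv hini hs hT _ hσ =>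
    prevPair_m1 hκq hsm hBT hΛ hcont hode herr henv hini hs hT hσ

end Summit.NavierStokesRegularity.NavierStokesRegularity.Theorems.PerpetualPumpAveragedTypeIBlowup

end
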